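import Summits.CriticalPhenomena.PercolationContinuityZ3.Theorems.Transplant.KNCells2KitAtChosen
import HarnessLib

/-!
# F8 (generic, lag-1 anchors), design (D): the RUN-RESTRICTED scheme — the probabilistic obligations of the node are owed ONLY at
# histories the scheme itself produces (`IsRun₂`), one level deeper than the chosen-edge restriction (lead ruling 15:15:37Z on the
# refuter's blocker of 15:15Z)

builds on p205010 (kernel theorem, internal audit signed; external expert review pending) — nothing in this file uses p205010.
Lane `prim-bschramm`, seat `prim-bschramm-p5` (gen 3, refuter; holder of residue (C)), helper file (`--supports stmt-CriticalPhenomena-4575`).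

WHY.  `Valid₂` constrains the explored region only through the coarse cover (cells and zones at the replayed anchors), so an ARBITRARY
valid history may carry explored, pinned-open junk right beside the fresh between-box `Btw_α(v,x)` at the child radius — fatal for the
rim excess of the corridor chain (`hreach`) of the concentric `X □ ℤ²` instance, harmless along RUNS (where `RunInv₂.V_cases` says the
explored region is `Q_0` plus the new regions of the earlier probes).  Since `lawful₂` consumes the failure bound only along runs, we
restrict the scheme's probing to run histories:
* `IsRun₂ S h := ∃ ω n, S.hst₂ G ω n = h`; `nextProbeRun₂` (= `nextProbe₂` at run histories, `none` elsewhere); `schemeRun₂`;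
* `hist_schemeRun₂` — the restricted scheme has THE SAME RUNS (`(schemeRun₂).E.hist n ω = hst₂ ω n`), hence the same macro-states,
  final clusters and initial event (`stN_schemeRun₂`, `occFinal_schemeRun₂`, `initEvent_schemeRun₂`);
* **`lawfulRun₂`** — lawfulness from (32) at the root and the failure bound asked only under `IsRun₂ h ∧ choice = some e ∧ Valid₂ h e`;
* **`theta_pos_of_cellsRun₂`**, **`theta_pos_of_kitRun₂`**, **`theta_pos_of_kitRun₂'`** — the node theorems with `hfail` / `hface` / `hreach`
  in run form (`hP1`/`hP2` unchanged); the bundled `KitAtRun` is in the companion file `KNCells2KitAtRun`.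
Every discharge of the chosen-edge (or all-edges) form still serves (the run form is WEAKER).  Along a run the instance gets `runInv₂`
(`V_cases`, `det_Q`, …) and all of `KNCells2Run`'s step lemmas.
[cite: KozmaNitzan2024, §4 Theorem 6 (pp. 25–31)]
-/

noncomputable section

open MeasureTheory ProbabilityTheory
open scoped ENNReal Classical

namespace Summit.CriticalPhenomena.PercolationContinuityZ3.Theorems

namespace Transplant

namespace KNCells

open Literature.Probability.Percolation Literature.Probability.LatticeModels SimpleGraph GadgetSystem ProbeHistory HSiteScheme Contour

namespace KSchA

section Defs

variable {V : Type*} [DecidableEq V] {A : Type*} (G : SimpleGraph V) [G.LocallyFinite] (S : KSchA V A)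

/-- **Run histories**: the histories produced by `scheme₂` on some configuration after some number of steps. [folklore] -/
def IsRun₂ (h : ProbeHistory V) : Prop := ∃ (ω : BondConfig V) (n : ℕ), S.hst₂ G ω n = h

/-- **The run-restricted next probe**: `nextProbe₂` at run histories, no probe elsewhere. [folklore] -/
def nextProbeRun₂ (h : ProbeHistory V) : Option (AProbe V) :=
  if S.IsRun₂ G h then S.nextProbe₂ G h else none

/-- **The run-restricted exploration process** (same initial edges and success criterion as `scheme₂`). [cite: KozmaNitzan2024, §4 pp. 26–27] -/
def schemeRun₂ : HSiteScheme V := ⟨⟨S.nextProbeRun₂ G⟩, S.U₀ G, S.succ₂' G⟩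

variable {G S}

/-- A history of the run is a run history. [folklore] -/
theorem isRun₂_hst₂ (ω : BondConfig V) (n : ℕ) : S.IsRun₂ G (S.hst₂ G ω n) := ⟨ω, n, rfl⟩

/-- At a run history the restricted next probe is `nextProbe₂`. [folklore] -/
theorem nextProbeRun₂_of_isRun {h : ProbeHistory V} (hr : S.IsRun₂ G h) : S.nextProbeRun₂ G h = S.nextProbe₂ G h := if_pos hr

/-- If the restricted scheme probes, the history is a run history and `nextProbe₂` probes. [folklore] -/
theorem nextProbeRun₂_eq_some {h : ProbeHistory V} {P : AProbe V} (hP : S.nextProbeRun₂ G h = some P) :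
    S.IsRun₂ G h ∧ S.nextProbe₂ G h = some P := by
  by_cases hr : S.IsRun₂ G h
  · exact ⟨hr, by rwa [nextProbeRun₂_of_isRun hr] at hP⟩
  · rw [nextProbeRun₂, if_neg hr] at hP; exact absurd hP (by simp)

/-- The explorer of the restricted scheme. [folklore] -/
theorem schemeRun₂_next : (S.schemeRun₂ G).E.next = S.nextProbeRun₂ G := rfl

/-- **The restricted scheme has the same runs.** [folklore] -/
theorem hist_schemeRun₂ (ω : BondConfig V) : ∀ n : ℕ, (S.schemeRun₂ G).E.hist n ω = S.hst₂ G ω n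
  | 0 => rfl
  | n + 1 => by
    rw [AExplorer.hist_succ, hist_schemeRun₂ ω n]
    show (S.schemeRun₂ G).E.step (S.hst₂ G ω n) ω :: S.hst₂ G ω n = (S.scheme₂ G).E.hist (n + 1) ω
    rw [AExplorer.hist_succ]
    have hstep : (S.schemeRun₂ G).E.step (S.hst₂ G ω n) ω = (S.scheme₂ G).E.step (S.hst₂ G ω n) ω := by
      show ((S.nextProbeRun₂ G (S.hst₂ G ω n)).map fun P => P.record ω) = ((S.nextProbe₂ G (S.hst₂ G ω n)).map fun P => P.record ω)
      rw [nextProbeRun₂_of_isRun (isRun₂_hst₂ ω n)]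
    rw [hstep]

/-- Hence the same replayed macro-states … [folklore] -/
theorem stN_schemeRun₂ (n : ℕ) (ω : BondConfig V) : (S.schemeRun₂ G).stN n ω = (S.scheme₂ G).stN n ω := by
  show HSiteScheme.mstOf (S.schemeRun₂ G).succ ((S.schemeRun₂ G).E.hist n ω) =
    HSiteScheme.mstOf (S.scheme₂ G).succ ((S.scheme₂ G).E.hist n ω)
  rw [hist_schemeRun₂]
  rfl

/-- … the same final occupied macro-clusters … [folklore] -/
theorem occFinal_schemeRun₂ (ω : BondConfig V) : (S.schemeRun₂ G).occFinal ω = (S.scheme₂ G).occFinal ω := by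
  simp only [HSiteScheme.occFinal, stN_schemeRun₂]

/-- … the same initial event … [folklore] -/
theorem initEvent_schemeRun₂ : (S.schemeRun₂ G).initEvent = (S.scheme₂ G).initEvent := rfl

/-- … and the same macro-state replay. [folklore] -/
theorem schemeRun₂_mst (h : ProbeHistory V) : (S.schemeRun₂ G).mst h = (S.astOf₂ G h).st := S.mst_eq_astOf₂ h

end Defs

section Node

variable {V : Type} [DecidableEq V] [Countable V]
variable {A : Type*} {G : SimpleGraph V} [G.LocallyFinite] {S : KSchA V A} {FD : FaceData V A} {LD : LevelData V A}

/-- **The run-restricted scheme is lawful from (32) at the root and the failure bound AT RUN HISTORIES, chosen edges only.**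
[cite: KozmaNitzan2024, §4 pp. 25–31] -/
theorem lawfulRun₂ (hΓ : RunGeom G S.Γ) (hA : AnchGeom S.Γ) (hsep : SepGeom₂ G S.Γ) {ε : ℝ}
    (hQ0 : ∀ du : MDir, 1 - S.δc < (prodBernoulli (pinW (KNLevels.lattW G S.p) ↑(S.U₀ G) ↑(S.U₀ G))).real
      (⋃ t ∈ (↑(S.Γ.M S.Γ.a₀ ((0 : Site 2) + stepVec du)) : Set V),
        openConnIn (↑(S.Γ.Q S.Γ.a₀ 0 ∪ S.Γ.Ewv S.Γ.a₀ 0 du) : Set V) S.Γ.root t))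
    (hfail : ∀ h e, S.IsRun₂ G h → (S.astOf₂ G h).st.choice = some e → S.Valid₂ G h e →
      (bondPercolation G S.p).real
        {ω | ¬S.succ₂ G h e (S.aOf₁ G h e) (S.aOf₂ G h e) ((S.probe₂ G h e (S.aOf₁ G h e) (S.aOf₂ G h e)).read ω)} ≤ ε) :
    (S.schemeRun₂ G).Lawful G S.p ε where
  fresh := by
    intro h P hP
    obtain ⟨-, hP'⟩ := nextProbeRun₂_eq_some hP
    obtain ⟨e, -, -, rfl⟩ := S.nextProbe₂_eq_some hP'
    constructor
    · rw [Set.disjoint_left]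
      intro x hx hxU
      exact (Finset.mem_sdiff.1 (Finset.mem_coe.1 hx)).2 (S.U₀_subset_F _ (Finset.mem_coe.1 hxU))
    · rw [Finset.disjoint_left]
      intro x hx hxs
      exact (Finset.mem_sdiff.1 hx).2 (Finset.mem_union_right _ hxs)
  probes := by
    intro ω _ n hc
    obtain ⟨e, he⟩ := Option.ne_none_iff_exists'.1 hc
    rw [stN_schemeRun₂] at he
    have hV : S.Valid₂ G (S.hst₂ G ω n) e := valid_of_choice₂ hΓ hA hsep hQ0 he
    have he' : (S.astOf₂ G (S.hst₂ G ω n)).st.choice = some e := by rw [← S.stN_eq₂]; exact he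
    show S.nextProbeRun₂ G ((S.schemeRun₂ G).E.hist n ω) ≠ none
    rw [hist_schemeRun₂, nextProbeRun₂_of_isRun (isRun₂_hst₂ ω n), S.nextProbe₂_of_valid he' hV]
    exact Option.some_ne_none _
  fail := by
    intro h P e hP hc
    obtain ⟨hr, hP'⟩ := nextProbeRun₂_eq_some hP
    obtain ⟨e', hc', hV, rfl⟩ := S.nextProbe₂_eq_some hP'
    have hc'' : (S.astOf₂ G h).st.choice = some e := by rw [← schemeRun₂_mst]; exact hc
    have hcc : some e' = some e := hc'.symm.trans hc''
    cases Option.some_injective _ hcc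
    exact hfail h _ hr hc'' hV

/-- **The anchored cells scheme forces `θ_{root}(p) > 0` — failure bound at RUN histories, chosen edges, no envelope bound.**
[cite: KozmaNitzan2024, §4 Theorem 6 (pp. 25–31)] -/
theorem theta_pos_of_cellsRun₂ (hΓ : RunGeom G S.Γ) (hA : AnchGeom S.Γ) (hsep : SepGeom₂ G S.Γ) (hX : ExitGeom G S.Γ)
    (hδc : S.δc ≤ 1) {ε : ℝ} (hε : ε ≤ (1 / 2) ^ 32) (hp : 0 < (S.p : ℝ))
    (hQ0 : ∀ du : MDir, 1 - S.δc < (prodBernoulli (pinW (KNLevels.lattW G S.p) ↑(S.U₀ G) ↑(S.U₀ G))).real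
      (⋃ t ∈ (↑(S.Γ.M S.Γ.a₀ ((0 : Site 2) + stepVec du)) : Set V),
        openConnIn (↑(S.Γ.Q S.Γ.a₀ 0 ∪ S.Γ.Ewv S.Γ.a₀ 0 du) : Set V) S.Γ.root t))
    (hfail : ∀ h e, S.IsRun₂ G h → (S.astOf₂ G h).st.choice = some e → S.Valid₂ G h e →
      (bondPercolation G S.p).real
        {ω | ¬S.succ₂ G h e (S.aOf₁ G h e) (S.aOf₂ G h e) ((S.probe₂ G h e (S.aOf₁ G h e) (S.aOf₂ G h e)).read ω)} ≤ ε) :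
    0 < theta G S.Γ.root S.p :=
  SameP.theta_pos_of_lawful (lawfulRun₂ hΓ hA hsep hQ0 hfail) hε
    (fun x hx => (mem_edgesIn_iff.1 (Finset.mem_coe.1 hx)).1) hp
    (by
      rintro ω' ⟨hA', hinf⟩
      have hinf' : ((S.scheme₂ G).occFinal ω').Infinite := by
        have h' : ((S.schemeRun₂ G).occFinal ω').Infinite := hinf
        rwa [occFinal_schemeRun₂] at h'
      exact Or.inl (mem_percolatesAt_of_infinite₂ hΓ hA hX (ω := ω') hδc hA' hinf'))

/-- **THE NODE OVER ANCHORED CELLS, KIT FORM, obligations at RUN histories and chosen edges.**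
[cite: KozmaNitzan2024, §4 Theorem 6 (pp. 25–31)] -/
theorem theta_pos_of_kitRun₂ (hΓ : RunGeom G S.Γ) (hA : AnchGeom S.Γ) (hsep : SepGeom₂ G S.Γ) (hX : ExitGeom G S.Γ)
    (hSt : StepsGeom S.Γ FD) (hδc : S.δc ≤ 1) {ε ε' δ₂ : ℝ} (hε : ε ≤ (1 / 2) ^ 32) (hε' : 0 ≤ ε') (hδ₂ : δ₂ ≤ 1)
    (hKε : 4 * ((1 - δ₂) ^ S.Γ.K + ε') ≤ ε) (hp : 0 < (S.p : ℝ))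
    (hQ0 : ∀ du : MDir, 1 - S.δc < (prodBernoulli (pinW (KNLevels.lattW G S.p) ↑(S.U₀ G) ↑(S.U₀ G))).real
      (⋃ t ∈ (↑(S.Γ.M S.Γ.a₀ ((0 : Site 2) + stepVec du)) : Set V),
        openConnIn (↑(S.Γ.Q S.Γ.a₀ 0 ∪ S.Γ.Ewv S.Γ.a₀ 0 du) : Set V) S.Γ.root t))
    (hP1 : ∀ h e, S.Valid₂ G h e → ∀ du ∈ S.onward G h (tgt e), ∀ ω,
      ω ∈ KNLevels.lattOnly G (S.Vx G h ∪ S.Γ.Ewv (S.aOf₁ G h e) e.1 e.2 ∪ FD.Hfull (S.aOf₂ G h e) (tgt e) du) →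
      ω ∈ S.Reach G FD h e (S.aOf₁ G h e) (S.aOf₂ G h e) du → ω ∈ S.Aface G FD h e (S.aOf₁ G h e) (S.aOf₂ G h e) du (S.Γ.K - 1))
    (hP2 : ∀ h e, S.Valid₂ G h e → ∀ du ∈ S.onward G h (tgt e), ∀ ω j, 1 ≤ j → j < S.Γ.K →
      ω ∈ KNLevels.lattOnly G (S.Vx G h ∪ S.Γ.Ewv (S.aOf₁ G h e) e.1 e.2 ∪ S.Γ.Stub (S.aOf₂ G h e) (tgt e) du (j + 1)) →
      ω ∈ S.Aface G FD h e (S.aOf₁ G h e) (S.aOf₂ G h e) du j → ω ∈ S.Aface G FD h e (S.aOf₁ G h e) (S.aOf₂ G h e) du (j - 1))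
    (hface : ∀ h e, S.IsRun₂ G h → (S.astOf₂ G h).st.choice = some e → S.Valid₂ G h e → ∀ du ∈ S.onward G h (tgt e),
      ∀ j < S.Γ.K, ∀ o : Finset (Sym2 V),
      1 - δ₂ < (prodBernoulli (S.Wt G h e (S.aOf₁ G h e) (S.aOf₂ G h e) du j o)).real
        (⋃ b ∈ FD.Face (S.aOf₂ G h e) (tgt e) du (j + 1), openConn S.Γ.root b) →
        S.cond G h e (S.aOf₁ G h e) (S.aOf₂ G h e) du j o)
    (hreach : ∀ h e, S.IsRun₂ G h → (S.astOf₂ G h).st.choice = some e → S.Valid₂ G h e → ∀ du ∈ S.onward G h (tgt e),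
      1 - ε' < (prodBernoulli (S.Wfull G h e (S.aOf₁ G h e) (S.aOf₂ G h e) du)).real
        (S.Reach G FD h e (S.aOf₁ G h e) (S.aOf₂ G h e) du)) :
    0 < theta G S.Γ.root S.p := by
  refine theta_pos_of_cellsRun₂ hΓ hA hsep hX hδc hε hp hQ0 fun h e hr hc hV => ?_
  exact (fail_bound₂ hV.anch hV hSt hε' hδ₂ (hP1 h e hV) (hP2 h e hV) (hface h e hr hc hV) (hreach h e hr hc hV)).trans hKε

/-- **THE NODE, kit form with a level geometry, obligations at RUN histories and chosen edges.**
[cite: KozmaNitzan2024, §4 Theorem 6 (pp. 25–31)] -/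
theorem theta_pos_of_kitRun₂' (hΓ : RunGeom G S.Γ) (hA : AnchGeom S.Γ) (hsep : SepGeom₂ G S.Γ) (hX : ExitGeom G S.Γ)
    (hSt : StepsGeom S.Γ FD) (hL : LevelGeom G S.Γ FD LD) (hδc : S.δc ≤ 1) {ε ε' δ₂ : ℝ} (hε : ε ≤ (1 / 2) ^ 32) (hε' : 0 ≤ ε')
    (hδ₂ : δ₂ ≤ 1) (hKε : 4 * ((1 - δ₂) ^ S.Γ.K + ε') ≤ ε) (hp : 0 < (S.p : ℝ))
    (hQ0 : ∀ du : MDir, 1 - S.δc < (prodBernoulli (pinW (KNLevels.lattW G S.p) ↑(S.U₀ G) ↑(S.U₀ G))).real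
      (⋃ t ∈ (↑(S.Γ.M S.Γ.a₀ ((0 : Site 2) + stepVec du)) : Set V),
        openConnIn (↑(S.Γ.Q S.Γ.a₀ 0 ∪ S.Γ.Ewv S.Γ.a₀ 0 du) : Set V) S.Γ.root t))
    (hface : ∀ h e, S.IsRun₂ G h → (S.astOf₂ G h).st.choice = some e → S.Valid₂ G h e → ∀ du ∈ S.onward G h (tgt e),
      ∀ j < S.Γ.K, ∀ o : Finset (Sym2 V),
      1 - δ₂ < (prodBernoulli (S.Wt G h e (S.aOf₁ G h e) (S.aOf₂ G h e) du j o)).real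
        (⋃ b ∈ FD.Face (S.aOf₂ G h e) (tgt e) du (j + 1), openConn S.Γ.root b) →
        S.cond G h e (S.aOf₁ G h e) (S.aOf₂ G h e) du j o)
    (hreach : ∀ h e, S.IsRun₂ G h → (S.astOf₂ G h).st.choice = some e → S.Valid₂ G h e → ∀ du ∈ S.onward G h (tgt e),
      1 - ε' < (prodBernoulli (S.Wfull G h e (S.aOf₁ G h e) (S.aOf₂ G h e) du)).real
        (S.Reach G FD h e (S.aOf₁ G h e) (S.aOf₂ G h e) du)) :
    0 < theta G S.Γ.root S.p :=
  theta_pos_of_kitRun₂ hΓ hA hsep hX hSt hδc hε hε' hδ₂ hKε hp hQ0 (fun _ _ hV => facePrefix₂_P1 hL hV)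
    (fun _ _ hV => facePrefix₂_P2 hL hSt hV) hface hreach

end Node

end KSchA

end KNCells

end Transplant

end Summit.CriticalPhenomena.PercolationContinuityZ3.Theorems

end
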